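import Literature.NumberTheory.GaloisRepresentations.DecompositionGroupOfCompletion
import Literature.NumberTheory.GaloisRepresentations.IntegralGaloisActionProofs
import HarnessLib

/-!
# Global subfields of `K̄` and their closures in `\bar K_v`

Topic `NumberTheory/GaloisRepresentations`; theorems only (no definition, no named fact), in the
setting of `DecompositionGroupOfCompletion`: `K` a number field, `v` a finite place,
`K_v = v.adicCompletion K`, `ι : K̄ → \bar K_v` the chosen `K`-embedding (`absClosureEmbedding`),
`res : Γ_{K_v} → Γ_K` the restriction along `ι` (`absGaloisRestrict`), `𝔓₀` the prime of `\bar ℤ_K`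
cut out by `ι` (`adicCompletionPrime`).  For a subfield `E ⊆ K̄` containing `K` write
`E_v = K_v(ι E) ⊆ \bar K_v` for the field it generates over `K_v` (for `E/K` finite this is the
completion of `E` at the place above `v` defined by `ι`, Neukirch Ch. II (8.3)).

* `mem_fixingSubgroup_adjoin_image_iff`, `mem_comap_fixingSubgroup_iff` — **the dictionary
  `Gal(\bar K_v / E_v) = res⁻¹ (Gal(K̄ / E))`**: `σ ∈ Γ_{K_v}` fixes `E_v` pointwise iff `res σ`
  fixes `E` pointwise.
* `smul_mem_of_normal` — a normal `E` is stable under `Γ_K`.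
* `exists_forall_smul_eq_of_forall_spectralNorm_eq` — **isometric conjugates are local conjugates**:
  if `E/K` is normal and `γ ∈ Γ_K` preserves the absolute value `|ι ·|_v` on `E`
  (`|ι (γ x)|_v = |ι x|_v` for `x ∈ E`), then `γ` agrees on `E` with `res σ` for some `σ ∈ Γ_{K_v}`
  (`ι (γ x) = σ (ι x)`).  Proof: `γ 𝔓₀` and `𝔓₀` contract to the same prime of `\bar ℤ_K ∩ E`, so
  they are conjugate under `Gal(K̄/E)` (transitivity on primes for the profinite group `Gal(K̄/E)`,
  Mathlib `Algebra.IsInvariant.exists_smul_of_under_eq_of_profinite`), and the stabiliser of `𝔓₀`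
  is `res (Γ_{K_v})` (`decompositionSubgroup_adicCompletionPrime_eq_range`).  This is the statement
  "two embeddings of `E` into `\bar K_v` defining the same place differ by an element of the
  decomposition group" (Neukirch, Ch. II (8.1)–(8.2) with (9.6)).

## References

* J. Neukirch, *Algebraic Number Theory*, Grundlehren 322 (1999), Ch. II (8.1)–(8.3), §9 (9.1),
  (9.6). [NeukirchANT1999]
* J.-P. Serre, *Local Fields*, GTM 67, Ch. II §3, Cor. 4. [SerreLocalFields1979]
-/

noncomputable section

open scoped NumberField Pointwise Valued
open Field IsDedekindDomain

universe u

namespace Literature.NumberTheory.GaloisRepresentations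

variable (K : Type u) [Field K] [NumberField K] (v : HeightOneSpectrum (𝓞 K))

/-! ### The dictionary `Gal(\bar K_v / E_v) = res⁻¹ Gal(K̄ / E)` -/

/-- `σ ∈ Γ_{K_v}` fixes `E_v = K_v(ι E)` pointwise iff it fixes `ι E` pointwise. [folklore] -/
theorem mem_fixingSubgroup_adjoin_image_iff (E : IntermediateField K (AlgebraicClosure K))
    (σ : absoluteGaloisGroup (v.adicCompletion K)) :
    absoluteGaloisGroup.toAlgEquiv (v.adicCompletion K) σ ∈
      (IntermediateField.adjoin (v.adicCompletion K)
        (absClosureEmbedding K (v.adicCompletion K) '' (E : Set (AlgebraicClosure K)))).fixingSubgroup ↔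
      ∀ x ∈ E, σ • absClosureEmbedding K (v.adicCompletion K) x =
        absClosureEmbedding K (v.adicCompletion K) x := by
  rw [IntermediateField.mem_fixingSubgroup_iff]
  constructor
  · intro h x hx
    exact h _ (IntermediateField.subset_adjoin _ _ ⟨x, hx, rfl⟩)
  · intro h y hy
    induction hy using IntermediateField.adjoin_induction with
    | mem y hy =>
        obtain ⟨x, hx, rfl⟩ := hy
        exact h x hx
    | algebraMap c => exact (absoluteGaloisGroup.toAlgEquiv (v.adicCompletion K) σ).commutes c
    | add x y _ _ hx hy =>
        rw [map_add]
        exact congrArg₂ (· + ·) hx hy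
    | inv x _ hx =>
        rw [map_inv₀]
        exact congrArg (·⁻¹) hx
    | mul x y _ _ hx hy =>
        rw [map_mul]
        exact congrArg₂ (· * ·) hx hy

/-- **`Gal(\bar K_v / E_v) = res⁻¹ Gal(K̄ / E)`**, elementwise: `σ ∈ Γ_{K_v}` fixes `ι E` pointwise
iff `res σ` fixes `E` pointwise (`ι (res σ • x) = σ • ι x` and `ι` is injective).
Neukirch, Ch. II (8.3) with §9 (9.6). [cite: NeukirchANT1999, Ch. II §9 Prop. (9.6)] -/
theorem forall_smul_absClosureEmbedding_eq_iff (E : IntermediateField K (AlgebraicClosure K))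
    (σ : absoluteGaloisGroup (v.adicCompletion K)) :
    (∀ x ∈ E, σ • absClosureEmbedding K (v.adicCompletion K) x =
        absClosureEmbedding K (v.adicCompletion K) x) ↔
      ∀ x ∈ E, absGaloisRestrict K (v.adicCompletion K) σ • x = x := by
  refine forall₂_congr fun x _ => ?_
  rw [← absGaloisRestrict_apply_smul]
  exact (absClosureEmbedding K (v.adicCompletion K)).injective.eq_iff

/-- `res σ` fixes `E` pointwise iff `res σ ∈ Gal(K̄/E) = E.fixingSubgroup`. [folklore] -/
theorem absGaloisRestrict_mem_fixingSubgroup_iff (E : IntermediateField K (AlgebraicClosure K))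
    (σ : absoluteGaloisGroup (v.adicCompletion K)) :
    absoluteGaloisGroup.toAlgEquiv K (absGaloisRestrict K (v.adicCompletion K) σ) ∈
        E.fixingSubgroup ↔
      ∀ x ∈ E, absGaloisRestrict K (v.adicCompletion K) σ • x = x := by
  rw [IntermediateField.mem_fixingSubgroup_iff]
  rfl

/-! ### Normal subfields are `Γ_K`-stable -/

variable {K} in
/-- A normal intermediate field `E ⊆ K̄` is stable under `Γ_K`. [folklore] -/
theorem smul_mem_of_normal (E : IntermediateField K (AlgebraicClosure K)) [Normal K E]
    (τ : absoluteGaloisGroup K) {x : AlgebraicClosure K} (hx : x ∈ E) : τ • x ∈ E := by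
  have h := (IntermediateField.normal_iff_forall_map_le'.1 (inferInstance : Normal K E))
    (absoluteGaloisGroup.toAlgEquiv K τ)
  exact h ⟨x, hx, rfl⟩

variable {K} in
/-- An element of `\bar ℤ_K` fixed by `Gal(K̄/E)` lies in `E` (Galois correspondence for the closed
subgroup `Gal(K̄/E)` of `Γ_K`; `K̄/K` is Galois). [folklore] -/
theorem mem_of_forall_fixingSubgroup_smul_eq (E : IntermediateField K (AlgebraicClosure K))
    {x : AlgebraicClosure K}
    (hx : ∀ g : absoluteGaloisGroup K, absoluteGaloisGroup.toAlgEquiv K g ∈ E.fixingSubgroup →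
      g • x = x) : x ∈ E := by
  rw [← InfiniteGalois.fixedField_fixingSubgroup E, IntermediateField.mem_fixedField_iff]
  intro f hf
  exact hx ((absoluteGaloisGroup.toAlgEquiv K).symm f) hf

/-! ### Isometric conjugates are local conjugates -/

/-- **Embeddings of a normal `E` defining the same place differ by an element of the decomposition
group.**  Let `E ⊆ K̄` be normal over `K` and `γ ∈ Γ_K` with `|ι (γ x)|_v = |ι x|_v` for all
`x ∈ E`.  Then there is `σ ∈ Γ_{K_v}` with `ι (γ x) = σ (ι x)` for all `x ∈ E`.
(The primes `γ 𝔓₀` and `𝔓₀` of `\bar ℤ_K` have the same contraction to the fixed ring of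
`Gal(K̄/E)`, hence are conjugate under `Gal(K̄/E)` — transitivity on primes for this profinite group,
Mathlib `Algebra.IsInvariant.exists_smul_of_under_eq_of_profinite` — and the stabiliser of `𝔓₀` is
`res Γ_{K_v}`.)  Neukirch, *Algebraic Number Theory*, Ch. II (8.1)–(8.2) and §9 (9.1), (9.6).
[cite: NeukirchANT1999, Ch. II §9 Prop. (9.6)] -/
theorem exists_forall_smul_eq_of_forall_spectralNorm_eq (E : IntermediateField K (AlgebraicClosure K))
    [Normal K E] (γ : absoluteGaloisGroup K)
    (hγ : ∀ x ∈ E, spectralNorm (v.adicCompletion K) (AlgebraicClosure (v.adicCompletion K))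
        (absClosureEmbedding K (v.adicCompletion K) (γ • x)) =
      spectralNorm (v.adicCompletion K) (AlgebraicClosure (v.adicCompletion K))
        (absClosureEmbedding K (v.adicCompletion K) x)) :
    ∃ σ : absoluteGaloisGroup (v.adicCompletion K), ∀ x ∈ E,
      absClosureEmbedding K (v.adicCompletion K) (γ • x) =
        σ • absClosureEmbedding K (v.adicCompletion K) x := by
  classical
  -- the subgroup `G' = Gal(K̄/E)` of `Γ_K`, as a profinite group acting on `\bar ℤ_K`
  set G' : Subgroup (absoluteGaloisGroup K) :=
    E.fixingSubgroup.comap (absoluteGaloisGroup.toAlgEquiv K).toMonoidHom with hG'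
  have hmemG' : ∀ g : absoluteGaloisGroup K, g ∈ G' ↔ ∀ x ∈ E, g • x = x := fun g => by
    rw [hG', Subgroup.mem_comap, MulEquiv.coe_toMonoidHom, IntermediateField.mem_fixingSubgroup_iff]
    rfl
  have hG'closed : IsClosed (G' : Set (absoluteGaloisGroup K)) := by
    rw [hG']
    show IsClosed ((E.fixingSubgroup : Set (AlgebraicClosure K ≃ₐ[K] AlgebraicClosure K)))
    exact InfiniteGalois.fixingSubgroup_isClosed E
  haveI : CompactSpace G' := isCompact_iff_compactSpace.mp hG'closed.isCompact
  letI : TopologicalSpace (absIntegers (𝓞 K) K) := ⊥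
  haveI : DiscreteTopology (absIntegers (𝓞 K) K) := ⟨rfl⟩
  haveI : ContinuousSMul (absoluteGaloisGroup K) (absIntegers (𝓞 K) K) :=
    absIntegers.continuousSMul (𝓞 K)
  haveI : Algebra.IsInvariant (FixedPoints.subring (absIntegers (𝓞 K) K) G') (absIntegers (𝓞 K) K)
      G' := ⟨fun b hb => ⟨⟨b, hb⟩, rfl⟩⟩
  haveI : SMulCommClass G' (FixedPoints.subring (absIntegers (𝓞 K) K) G') (absIntegers (𝓞 K) K) :=
    ⟨fun g a b => by
      show g • ((a : absIntegers (𝓞 K) K) * b) = (a : absIntegers (𝓞 K) K) * g • b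
      rw [smul_mul', show g • (a : absIntegers (𝓞 K) K) = a from a.2 g]⟩
  -- elements of the fixed ring `A = \bar ℤ_K ^ {Gal(K̄/E)}` lie in `E`
  have hAE : ∀ a : FixedPoints.subring (absIntegers (𝓞 K) K) G',
      ((a : absIntegers (𝓞 K) K) : AlgebraicClosure K) ∈ E := by
    rintro ⟨a, ha⟩
    refine mem_of_forall_fixingSubgroup_smul_eq E fun g hg => ?_
    have hgG' : g ∈ G' := by rw [hG', Subgroup.mem_comap]; exact hg
    have := ha ⟨g, hgG'⟩
    have h2 : ((((⟨g, hgG'⟩ : G') • a : absIntegers (𝓞 K) K)) : AlgebraicClosure K) =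
        g • (a : AlgebraicClosure K) := rfl
    rw [← h2, this]
  -- the primes `𝔓₀` and `γ • 𝔓₀` contract to the same prime of `A`
  set 𝔓 : Ideal (absIntegers (𝓞 K) K) := adicCompletionPrime K v with h𝔓
  have hunder : 𝔓.under (FixedPoints.subring (absIntegers (𝓞 K) K) G') =
      (γ • 𝔓).under (FixedPoints.subring (absIntegers (𝓞 K) K) G') := by
    ext a
    rw [Ideal.under_def, Ideal.under_def, Ideal.mem_comap, Ideal.mem_comap,
      Ideal.mem_pointwise_smul_iff_inv_smul_mem]
    change (a : absIntegers (𝓞 K) K) ∈ 𝔓 ↔ γ⁻¹ • (a : absIntegers (𝓞 K) K) ∈ 𝔓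
    rw [h𝔓, mem_adicCompletionPrime_iff, mem_adicCompletionPrime_iff, integralClosure.coe_smul]
    have haE := hAE a
    have h1 := hγ (γ⁻¹ • ((a : absIntegers (𝓞 K) K) : AlgebraicClosure K))
      (smul_mem_of_normal E γ⁻¹ haE)
    rw [smul_inv_smul] at h1
    rw [h1]
  -- transitivity of `Gal(K̄/E)` on the primes above
  obtain ⟨g, hg⟩ := Algebra.IsInvariant.exists_smul_of_under_eq_of_profinite
    (A := FixedPoints.subring (absIntegers (𝓞 K) K) G') (G := G') 𝔓 (γ • 𝔓) hunder
  have hg' : γ • 𝔓 = (g : absoluteGaloisGroup K) • 𝔓 := hg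
  have hstab : ((g : absoluteGaloisGroup K)⁻¹ * γ) • 𝔓 = 𝔓 := by
    rw [mul_smul, hg', inv_smul_smul]
  have hD : (g : absoluteGaloisGroup K)⁻¹ * γ ∈
      (adicCompletionPrime K v).decompositionSubgroup (absoluteGaloisGroup K) :=
    Ideal.mem_decompositionSubgroup_iff.mpr hstab
  rw [decompositionSubgroup_adicCompletionPrime_eq_range] at hD
  obtain ⟨σ, hσ⟩ := hD
  refine ⟨σ, fun x hx => ?_⟩
  have hgfix : ∀ y ∈ E, (g : absoluteGaloisGroup K) • y = y := (hmemG' g).1 g.2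
  have h1 : γ • x = (g : absoluteGaloisGroup K) • (absGaloisRestrict K (v.adicCompletion K) σ • x) := by
    rw [show (absGaloisRestrict K (v.adicCompletion K) σ : absoluteGaloisGroup K) =
        (g : absoluteGaloisGroup K)⁻¹ * γ from hσ, ← mul_smul, mul_inv_cancel_left]
  rw [h1, hgfix _ (smul_mem_of_normal E _ hx), absGaloisRestrict_apply_smul]

end Literature.NumberTheory.GaloisRepresentations
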